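import Literature.NumberTheory.LFunctions.ThetaChainFreeCheck
import HarnessLib

/-!
# Schoenfeld's `θ`-bound on `[599, 10⁸]` by kernel computation: data-free run, chunk 19 of 35

Topic: `Literature/NumberTheory/LFunctions`. Pure proof file (a kernel computation; nothing is
asserted, no definition). The theorems below evaluate `ThetaChain.runFree` — together `150000`
data-free steps of the certified `θ`-chain (`ThetaChain.stepFree`, `ThetaChainFreeCheck.lean`: the
next prime found and certified by two gcds with the primorials of the odd primes `≤ 2999` and in
`(2999, 10007]`, the enclosures of `log p` and `θ(p)`, and the two comparisons behind
`|θ(x) − x| ≤ √x log² x/(8π)`) — from the state at the prime `55233149` to the state at the prime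
`57910103`. Soundness: `ThetaChain.runFree_sound`; assembly of the 35 chunks: `ThetaUpTo1e8.lean`.
The expected states were obtained by evaluating a twin of the same function outside the kernel
(validated bit-for-bit on the tree's chunk `ThetaChainRun.xrun14`). Declarations of `5·10⁴` steps
(about `70 s` of kernel time each; the kernel's evaluation is linear within a declaration of this size),
`decide +kernel`, standard axioms only (`maxHeartbeats 0` lifts the deterministic time-out).

## References

* L. Schoenfeld, *Sharper bounds for the Chebyshev functions θ(x) and ψ(x). II*, Math. Comp. 30
  (1976), 337–360, Thm. 10 (6.3). [Schoenfeld1976]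
* J. B. Rosser, L. Schoenfeld, *Approximate formulas for some functions of prime numbers*,
  Illinois J. Math. 6 (1962), 64–94, Thms. 18–19 (`θ`-tables to `10⁸`). [RosserSchoenfeld1962]
-/

namespace Literature.NumberTheory.LFunctions.ThetaChainRun

open ThetaChain

set_option maxHeartbeats 0 in
/-- **Data-free certified `θ`-run, chunk 19a** (steps `2700001`–`2750000` after `8886113`: 50000 primes,
`55233149` to `56124329`). [cite: Schoenfeld1976, Thm. 10 (6.3)] -/
theorem frun19a :
    runFree 50000
      ⟨55233149, 21551609873138094974019184, 21551609873138570646790321, 66761926215500193991797480793541, 66761926215501761389527433246260⟩ =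
    some ⟨56124329, 21570960051187855783956393, 21570960051188331457679310, 67839992627811311288322190908671, 67839992627812902469714495997830⟩ := by
  decide +kernel

set_option maxHeartbeats 0 in
/-- **Data-free certified `θ`-run, chunk 19b** (steps `2750001`–`2800000` after `8886113`: 50000 primes,
`56124329` to `57016121`). [cite: Schoenfeld1976, Thm. 10 (6.3)] -/
theorem frun19b :
    runFree 50000
      ⟨56124329, 21570960051187855783956393, 21570960051188331457679310, 67839992627811311288322190908671, 67839992627812902469714495997830⟩ =
    some ⟨57016121, 21590018357965125697390704, 21590018357965601372065436, 68919018427234472704187514864350, 68919018427236087669289763158099⟩ := by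
  decide +kernel

set_option maxHeartbeats 0 in
/-- **Data-free certified `θ`-run, chunk 19c** (steps `2800001`–`2850000` after `8886113`: 50000 primes,
`57016121` to `57910103`). [cite: Schoenfeld1976, Thm. 10 (6.3)] -/
theorem frun19c :
    runFree 50000
      ⟨57016121, 21590018357965125697390704, 21590018357965601372065436, 68919018427234472704187514864350, 68919018427236087669289763158099⟩ =
    some ⟨57910103, 21608826593087406404559209, 21608826593087882080185766, 69998989963260865341205263544169, 69998989963262504090065044295458⟩ := by
  decide +kernel

end Literature.NumberTheory.LFunctions.ThetaChainRun
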